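import Summits.QuantumFields.YangMills.Theorems.BalabanUVNodesN27AtRecord13CoPHHolder
import Summits.QuantumFields.YangMills.Theorems.BalabanUVNodesN27ReadOutAtU3OfKernels

/-!
# BalabanUVNodes ∕ N27 = binder B5 AT THE RECORD — module (K): THE K3⁷ REDUCTION AT A STAGE-13 RATE READING **PINNED TO node00-def-W1's KERNEL-KEYED U3 OBJECTS OF RECORD**
# `U3OfKernels.objectsOfRecord₁₃` (W1-19, p590183; plan g81 Q1 RULING (β): «node U3's object OF RECORD»), THE THREE U3-KEYED K4 SLOTS IN KERNEL CURRENCY —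
# **(D4) ⟸ print's (5.10)** `KernelDecayOfRecord₁₃ F N θ 0 1 κ` (this seat's g0 closer `…N27ReadOutAtU3OfKernels.readOutAt_objectsOfRecord₁₃_coPH`, p591653), **N17 ELIMINATED**
# (dag-n17-a `YMDAG.N17.s_N17_of_D4_N18`), **N18 ∕ N22 at the kernel bundle** `u3OfRecord₁₃ θ (objectsOfRecord₁₃ F N θ ℓ) k` as guarded θ-form binders (the shapes dag-n18-w1's
# `…N18AtU3OfKernels` ∕ dag-n22-w3's `…N22AtU3OfKernels` conclude); N14 ∕ N15 generic, N16 IN ITS CURRENCY OF RECORD «R-β»; over (Q) `…N27AtRecord13CoPHHolder` §1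
# `spine_rec13CCoPHOn_of_homes₁₃CoPHOn_holder` BY NAME
# (cell `pub-ymgap`, HUMAN RULING D-0062 Track A; director-ym №197 ∕ HUMAN RULING D-0149; width seat `pub-ymgap-dag-n27-w1` gen 2 on NODE n27 (B5 composite); K3⁷
# `SpineGivenEndpointR13SepCoPH` = stmt-QuantumFields-20544, `--kind proof --supports 20544 --as helper`; COUNT-NEUTRAL; THEOREMS ONLY, 0 `def`, 0 `sorry`; `N`-generic,
# regime-generic, NO Theses import — the item-facing face is leaf (K′) `…N27SpineGivenEndpointR13SepCoPHKernels`)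

THE PIN.  `𝔯 : RateReading₁₃CoPH N` is ANY Stage-13 rate reading whose node-U3 objects are def-W1's kernel objects of record, letter block `ℓ F θ`:
`hpin : ∀ F θ hP g₀ os, (𝔯.lit F θ hP g₀ os).u3 = objectsOfRecord₁₃ F N θ.toStage13Params (ℓ F θ)` — dag-n18-w2's ∕ dag-n18-w1's ∕ dag-n22-w3's pin shape VERBATIM, so their
`…_rateCarriers_of_kernels_pin` faces and this composer meet in ONE witness `𝔯` of the K3⁷ skeleton's `∃ 𝔯` (v2 145a664ea9c38a7b UNTOUCHED; no reading is minted here).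

WHAT IS KERNEL-CHECKED ([bookkeeping]).
* §1 THE U3 SLOTS UNDER THE PIN: `s_D4 ∕ s_N17 ∕ s_N18 ∕ s_N22_rRec₁₃CoPHOn_iff_of_kernels_pin` (each stub at `RRec₁₃CoPHOn 𝔯 Rg` IS its guarded θ-form at the kernel bundle of record) ·
  ★ `s_D4_rRec₁₃CoPHOn_of_kernels_pin` ((D4) from `(ℓ F θ).Signs`, `0 < κ`, `betaPrime510 4 1 κ ≤ cr` and the ONE (5.10) clause `KernelDecayOfRecord₁₃ F N θ.toStage13Params 0 1 (ℓ F θ).κ`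
  per guarded tuple) · ★ `s_N17_rRec₁₃CoPHOn_of_kernels_pin` (N17 from the same four + the N18 binder; N22 NOT needed at Stage 13 — `s_N17_of_D4_N18`).
* §2 ★★ `spine_rec13CCoPHOn_holder_of_kernels_pin` — N27 = B5 at node00-def-RR-2's regime record class `IsRecordOfRecord₁₃CCoPHOn F N Rg` from: the pin; N14 ∕ N15 ∕ N16-at-β as
  the stubs `S_N14 ∕ S_N15 ∕ S_N16Holder β (RRec₁₃CoPHOn 𝔯 Rg)`; N18 ∕ N22 in guarded θ-form AT THE KERNEL BUNDLE; the four (D4) inputs; K5's `h20 h21`; the spine-side representation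
  `hx`; the N19′ edge `h19` reading `RatesHolderAt … β` — verbatim from (Q) §1.  ★★ `spine_rec13CCoPHOn_holder_of_kernels_pin_bundled` — the same with N18 ∕ N22 stated on the
  run-length bundles `(rateCarriersOfRecord₁₃CoPH 𝔯 F θ hP g₀ os k).u3` (the producers' `…_rateCarriers_of_kernels_pin` conclusion shape, socket form).

HONEST FRAMING.  COMPOSITE-node bookkeeping BY NAME; a REDUCTION, not a discharge: (D4) at the record ⟸ (5.10) for the LIMITING (1.21) kernels of the merged term of record +
letter inequalities — (5.10) is print's claim ([Balaban1987RG1] p. 293 «yields»), NOT proved here or anywhere in the tree at these objects; the existence of the limit (1.21) is NOT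
asserted (`polLimit` is a total `limUnder`); NE5 ∕ NE9 at those kernels, NE1′, NE2, NE3 at exponent β, the NE7-cluster estimates, the K5 stubs and the N19′ edge are DISPLAYED
HYPOTHESES inhabited for no family today (K0⁷ `Record13SepCoPHInhabited` OPEN); β is a LETTER; nothing of Bałaban's asserted or instantiated; no `Provisos₁₃CoPH` inhabitant claimed;
N17 ∕ N18 ∕ N22 ∕ N27 NOT discharged; K3⁷ OPEN, NOT claimed; every landed decl UNTOUCHED (additive file); counts UNMOVED (typed 28∕28 · discharged 5∕27, A 5∕28); one finite
four-torus programme at fixed `ε` — R4 closes the conditional rung `BalabanLadder.UV` only: NOT ℝ⁴, NOT infinite volume, NOT OS, NOT a mass gap, NOT Clay.  No decl below carries a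
cite tag.
-/

set_option autoImplicit false

namespace Summit.QuantumFields.YangMills.Theorems.BalabanUVNodesN27SpineRecord

open Literature.MathematicalPhysics.QuantumFieldTheory.Balaban1983to89
open Literature.MathematicalPhysics.QuantumFieldTheory.Balaban1983to89.T4Continuum
open Literature.MathematicalPhysics.QuantumFieldTheory.Balaban1983to89.B12Sec2to5 (betaPrime510)
open Literature.MathematicalPhysics.QuantumFieldTheory.Balaban1983to89.Node00.U3OfKernels (objectsOfRecord₁₃ KernelDecayOfRecord₁₃)
open T4ContinuumYM4Torus (ForSmallCouplings)
open Summit.QuantumFields.BalabanUV.T4Continuum.Spine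
open YMDAG.UVSplit
open Node00 (Stage13HParams datumOfRecord₁₃CoPH U3Letters₁₁)
open Summit.QuantumFields.YangMills.BalabanUVNodes.N16HolderDefs (N16HolderAt S_N16Holder)
open Summit.QuantumFields.YangMills.BalabanUVNodes.SpineRatesHolder (RatesHolderAt)
open Summit.QuantumFields.YangMills.BalabanUVNodes.N27ReadOutAtU3OfKernels (readOutAt_objectsOfRecord₁₃_coPH)

variable {N : ℕ} [NeZero N] (cr : SpineReading₁₃CoPH N) (β : ℝ) (𝔯 : RateReading₁₃CoPH N) (Rg : (F : T4Family) → Stage13HParams F N → Prop)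
  (ℓ : (F : T4Family) → Stage13HParams F N → U3Letters₁₁)

/-! ## §1 The three U3-keyed K4 slots at a kernel-pinned reading -/

section Slots

variable (hpin : ∀ (F : T4Family) (θ : Stage13HParams F N) (hP : θ.Provisos₁₃CoPH F N) (g₀ : ℕ → ℝ) (os : List (ULoop F)),
    (𝔯.lit F θ hP g₀ os).u3 = objectsOfRecord₁₃ F N θ.toStage13Params (ℓ F θ))
include hpin

/-- **(D4) AT A KERNEL-PINNED READING — guarded θ-form**: `S_D4 (RRec₁₃CoPHOn 𝔯 Rg)` IS «at every admissible tuple with provisos in the regime and every run length `k`,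
`ReadOutAt (datumOfRecord₁₃CoPH F N θ hP) (u3OfRecord₁₃ θ (objectsOfRecord₁₃ F N θ (ℓ F θ)) k)`» (`s_D4_rRec₁₃CoPHOn_iff` along the pin; `g₀, os` idle). [bookkeeping] -/
theorem s_D4_rRec₁₃CoPHOn_iff_of_kernels_pin :
    S_D4 (RRec₁₃CoPHOn 𝔯 Rg) ↔ ∀ (F : T4Family) (θ : Stage13HParams F N) (hP : θ.Provisos₁₃CoPH F N), Rg F θ → θ.Admissible F N → ∀ k : ℕ,
      ReadOutAt (datumOfRecord₁₃CoPH F N θ hP) (u3OfRecord₁₃ θ.toStage13Params (objectsOfRecord₁₃ F N θ.toStage13Params (ℓ F θ)) k) := by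
  rw [s_D4_rRec₁₃CoPHOn_iff]
  refine ⟨fun h F θ hP hRg hθ k => ?_, fun h F θ hP hRg hθ g₀ os k => ?_⟩
  · simpa only [hpin F θ hP (fun _ => 0) []] using h F θ hP hRg hθ (fun _ => 0) [] k
  · simpa only [hpin F θ hP g₀ os] using h F θ hP hRg hθ k

/-- **N17 AT A KERNEL-PINNED READING — guarded θ-form** (on the datum). [bookkeeping] -/
theorem s_N17_rRec₁₃CoPHOn_iff_of_kernels_pin :
    S_N17 (RRec₁₃CoPHOn 𝔯 Rg) ↔ ∀ (F : T4Family) (θ : Stage13HParams F N) (hP : θ.Provisos₁₃CoPH F N), Rg F θ → θ.Admissible F N → ∀ k : ℕ,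
      N17At (datumOfRecord₁₃CoPH F N θ hP) (u3OfRecord₁₃ θ.toStage13Params (objectsOfRecord₁₃ F N θ.toStage13Params (ℓ F θ)) k) := by
  rw [s_N17_rRec₁₃CoPHOn_iff]
  refine ⟨fun h F θ hP hRg hθ k => ?_, fun h F θ hP hRg hθ g₀ os k => ?_⟩
  · simpa only [hpin F θ hP (fun _ => 0) []] using h F θ hP hRg hθ (fun _ => 0) [] k
  · simpa only [hpin F θ hP g₀ os] using h F θ hP hRg hθ k

/-- **N18 AT A KERNEL-PINNED READING — guarded θ-form**: NE5 at every member `b ≤ θ.γ` of the kernel bundle of record, every run length. [bookkeeping] -/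
theorem s_N18_rRec₁₃CoPHOn_iff_of_kernels_pin :
    S_N18 (RRec₁₃CoPHOn 𝔯 Rg) ↔ ∀ (F : T4Family) (θ : Stage13HParams F N), θ.Provisos₁₃CoPH F N → Rg F θ → θ.Admissible F N → ∀ k : ℕ,
      N18At (u3OfRecord₁₃ θ.toStage13Params (objectsOfRecord₁₃ F N θ.toStage13Params (ℓ F θ)) k) := by
  rw [s_N18_rRec₁₃CoPHOn_iff]
  refine ⟨fun h F θ hP hRg hθ k => ?_, fun h F θ hP hRg hθ g₀ os k => ?_⟩
  · simpa only [hpin F θ hP (fun _ => 0) []] using h F θ hP hRg hθ (fun _ => 0) [] k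
  · simpa only [hpin F θ hP g₀ os] using h F θ hP hRg hθ k

/-- **N22 AT A KERNEL-PINNED READING — guarded θ-form**: NE9 ∧ fading memory of the kernel bundle of record, every run length. [bookkeeping] -/
theorem s_N22_rRec₁₃CoPHOn_iff_of_kernels_pin :
    S_N22 (RRec₁₃CoPHOn 𝔯 Rg) ↔ ∀ (F : T4Family) (θ : Stage13HParams F N), θ.Provisos₁₃CoPH F N → Rg F θ → θ.Admissible F N → ∀ k : ℕ,
      N22At (u3OfRecord₁₃ θ.toStage13Params (objectsOfRecord₁₃ F N θ.toStage13Params (ℓ F θ)) k) := by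
  rw [s_N22_rRec₁₃CoPHOn_iff]
  refine ⟨fun h F θ hP hRg hθ k => ?_, fun h F θ hP hRg hθ g₀ os k => ?_⟩
  · simpa only [hpin F θ hP (fun _ => 0) []] using h F θ hP hRg hθ (fun _ => 0) [] k
  · simpa only [hpin F θ hP g₀ os] using h F θ hP hRg hθ k

/-- ★ **(D4) AT A KERNEL-PINNED READING FROM PRINT's (5.10)**: `S_D4 (RRec₁₃CoPHOn 𝔯 Rg)` from, per guarded tuple, the letter signs `(ℓ F θ).Signs`, `0 < κ`,
`betaPrime510 4 1 κ ≤ cr` and the ONE (5.10) clause `KernelDecayOfRecord₁₃ F N θ.toStage13Params 0 1 (ℓ F θ).κ` (g0 `readOutAt_objectsOfRecord₁₃_coPH`: `RepresentsA∕B` hold BY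
CONSTRUCTION at the objects of record, `ReadBoundedOn∕ReadCovariantOn` by (5.10) ⇒ (5.42)).  A reduction; (5.10) NOT proved. [bookkeeping] -/
theorem s_D4_rRec₁₃CoPHOn_of_kernels_pin
    (hs : ∀ (F : T4Family) (θ : Stage13HParams F N), θ.Provisos₁₃CoPH F N → Rg F θ → θ.Admissible F N → (ℓ F θ).Signs)
    (hκ : ∀ (F : T4Family) (θ : Stage13HParams F N), θ.Provisos₁₃CoPH F N → Rg F θ → θ.Admissible F N → 0 < (ℓ F θ).κ)
    (hcr : ∀ (F : T4Family) (θ : Stage13HParams F N), θ.Provisos₁₃CoPH F N → Rg F θ → θ.Admissible F N → betaPrime510 4 1 (ℓ F θ).κ ≤ (ℓ F θ).cr)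
    (hdec : ∀ (F : T4Family) (θ : Stage13HParams F N), θ.Provisos₁₃CoPH F N → Rg F θ → θ.Admissible F N → KernelDecayOfRecord₁₃ F N θ.toStage13Params 0 1 (ℓ F θ).κ) :
    S_D4 (RRec₁₃CoPHOn 𝔯 Rg) :=
  (s_D4_rRec₁₃CoPHOn_iff_of_kernels_pin 𝔯 Rg ℓ hpin).mpr fun F θ hP hRg hθ k =>
    readOutAt_objectsOfRecord₁₃_coPH θ hP (ℓ F θ) (hs F θ hP hRg hθ) (hκ F θ hP hRg hθ) (hcr F θ hP hRg hθ) k (hdec F θ hP hRg hθ)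

/-- ★ **N17 ELIMINATED AT A KERNEL-PINNED READING**: `S_N17 (RRec₁₃CoPHOn 𝔯 Rg)` from the four (D4) inputs and the N18 binder at the kernel bundle (dag-n17-a `s_N17_of_D4_N18`:
at Stage 13 the letter signs behind `FadingMemory` come with the bundle, so N22 is not needed for N17).  NE4 ∕ NE5 NOT proved. [bookkeeping] -/
theorem s_N17_rRec₁₃CoPHOn_of_kernels_pin
    (hs : ∀ (F : T4Family) (θ : Stage13HParams F N), θ.Provisos₁₃CoPH F N → Rg F θ → θ.Admissible F N → (ℓ F θ).Signs)
    (hκ : ∀ (F : T4Family) (θ : Stage13HParams F N), θ.Provisos₁₃CoPH F N → Rg F θ → θ.Admissible F N → 0 < (ℓ F θ).κ)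
    (hcr : ∀ (F : T4Family) (θ : Stage13HParams F N), θ.Provisos₁₃CoPH F N → Rg F θ → θ.Admissible F N → betaPrime510 4 1 (ℓ F θ).κ ≤ (ℓ F θ).cr)
    (hdec : ∀ (F : T4Family) (θ : Stage13HParams F N), θ.Provisos₁₃CoPH F N → Rg F θ → θ.Admissible F N → KernelDecayOfRecord₁₃ F N θ.toStage13Params 0 1 (ℓ F θ).κ)
    (h18 : ∀ (F : T4Family) (θ : Stage13HParams F N), θ.Provisos₁₃CoPH F N → Rg F θ → θ.Admissible F N → ∀ k : ℕ,
      N18At (u3OfRecord₁₃ θ.toStage13Params (objectsOfRecord₁₃ F N θ.toStage13Params (ℓ F θ)) k)) :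
    S_N17 (RRec₁₃CoPHOn 𝔯 Rg) :=
  YMDAG.N17.s_N17_of_D4_N18 _ (s_D4_rRec₁₃CoPHOn_of_kernels_pin 𝔯 Rg ℓ hpin hs hκ hcr hdec) ((s_N18_rRec₁₃CoPHOn_iff_of_kernels_pin 𝔯 Rg ℓ hpin).mpr h18)

end Slots

/-! ## §2 N27 = B5 at the regime record class from a kernel-pinned reading -/

/-- ★★ **N27 = B5 AT node00-def-RR-2's REGIME RECORD CLASS FROM A KERNEL-PINNED STAGE-13 RATE READING** ((Q) §1 `spine_rec13CCoPHOn_of_homes₁₃CoPHOn_holder` with the three U3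
slots supplied in KERNEL currency): the pin `hpin`; N14 ∕ N15 ∕ N16-at-exponent-β as the stubs at the regime home of `𝔯`; **N18 ∕ N22 in guarded θ-form at the kernel bundle of
record**; **(D4) from `(ℓ F θ).Signs`, `0 < κ`, `betaPrime510 4 1 κ ≤ cr` and the (5.10) clause `KernelDecayOfRecord₁₃ F N θ.toStage13Params 0 1 (ℓ F θ).κ`**; N17 eliminated;
K5's `h20 h21` at the regime spine home, the spine-side representation `hx`, the N19′ edge `h19` reading `RatesHolderAt … β` — verbatim from (Q) §1.  Every displayed antecedent is a
HYPOTHESIS (0∕1 at the ₁₃ record today); (5.10), NE5, NE9, NE1′, NE2, NE3 at exponent β, NE7-cluster NOT PROVED; N27 NOT discharged. [bookkeeping] -/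
theorem spine_rec13CCoPHOn_holder_of_kernels_pin
    (hpin : ∀ (F : T4Family) (θ : Stage13HParams F N) (hP : θ.Provisos₁₃CoPH F N) (g₀ : ℕ → ℝ) (os : List (ULoop F)),
      (𝔯.lit F θ hP g₀ os).u3 = objectsOfRecord₁₃ F N θ.toStage13Params (ℓ F θ))
    (h14 : S_N14 (RRec₁₃CoPHOn 𝔯 Rg)) (h15 : S_N15 (RRec₁₃CoPHOn 𝔯 Rg)) (h16 : S_N16Holder β (RRec₁₃CoPHOn 𝔯 Rg))
    (h18 : ∀ (F : T4Family) (θ : Stage13HParams F N), θ.Provisos₁₃CoPH F N → Rg F θ → θ.Admissible F N → ∀ k : ℕ,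
      N18At (u3OfRecord₁₃ θ.toStage13Params (objectsOfRecord₁₃ F N θ.toStage13Params (ℓ F θ)) k))
    (h22 : ∀ (F : T4Family) (θ : Stage13HParams F N), θ.Provisos₁₃CoPH F N → Rg F θ → θ.Admissible F N → ∀ k : ℕ,
      N22At (u3OfRecord₁₃ θ.toStage13Params (objectsOfRecord₁₃ F N θ.toStage13Params (ℓ F θ)) k))
    (hs : ∀ (F : T4Family) (θ : Stage13HParams F N), θ.Provisos₁₃CoPH F N → Rg F θ → θ.Admissible F N → (ℓ F θ).Signs)
    (hκ : ∀ (F : T4Family) (θ : Stage13HParams F N), θ.Provisos₁₃CoPH F N → Rg F θ → θ.Admissible F N → 0 < (ℓ F θ).κ)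
    (hcr : ∀ (F : T4Family) (θ : Stage13HParams F N), θ.Provisos₁₃CoPH F N → Rg F θ → θ.Admissible F N → betaPrime510 4 1 (ℓ F θ).κ ≤ (ℓ F θ).cr)
    (hdec : ∀ (F : T4Family) (θ : Stage13HParams F N), θ.Provisos₁₃CoPH F N → Rg F θ → θ.Admissible F N → KernelDecayOfRecord₁₃ F N θ.toStage13Params 0 1 (ℓ F θ).κ)
    (h20 : S_N20 (SRec₁₃CoPHOn cr Rg)) (h21 : S_N21 (SRec₁₃CoPHOn cr Rg))
    (hx : ∀ (F : T4Family) (θ : Stage13HParams F N) (hP : θ.Provisos₁₃CoPH F N), Rg F θ → θ.Admissible F N →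
      B16.EndStatementBPrinted (datumOfRecord₁₃CoPH F N θ hP).C → DagBinding.EndpointExistence (datumOfRecord₁₃CoPH F N θ hP).C.toB12 →
        ForSmallCouplings (datumOfRecord₁₃CoPH F N θ hP) fun g₀ => ∀ os : List (ULoop F),
          0 < (cr F θ hP g₀ os).l₀ ∧ 0 < (cr F θ hP g₀ os).vol ∧
          (∀ (K : ℕ) (t : ℝ), |t| ≤ (cr F θ hP g₀ os).l₀ →
            T4GenFunBounds.schemeZ ((datumOfRecord₁₃CoPH F N θ hP).scheme g₀) os ((cr F θ hP g₀ os).K₀ + K) t =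
              ∑ τ ∈ (cr F θ hP g₀ os).T K, (cr F θ hP g₀ os).A K t τ) ∧
          (∀ (K : ℕ) (t : ℝ), |t| ≤ (cr F θ hP g₀ os).l₀ →
            T4GenFunBounds.schemeZ ((datumOfRecord₁₃CoPH F N θ hP).scheme g₀) os ((cr F θ hP g₀ os).K₀ + K + 1) t =
              ∑ τ ∈ (cr F θ hP g₀ os).T K, (cr F θ hP g₀ os).B K t τ))
    (h19 : ∀ (F : T4Family) (θ : Stage13HParams F N) (hP : θ.Provisos₁₃CoPH F N), Rg F θ → θ.Admissible F N → ∀ (g₀ : ℕ → ℝ) (os : List (ULoop F)),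
      (∀ k : ℕ, RatesHolderAt (datumOfRecord₁₃CoPH F N θ hP) (rateCarriersOfRecord₁₃CoPH 𝔯 F θ hP g₀ os k) β) → letI := (cr F θ hP g₀ os).dec
        ∃ δ : ℕ → ℝ, NE7.Core (cr F θ hP g₀ os).l₀ (cr F θ hP g₀ os).vol (cr F θ hP g₀ os).T (cr F θ hP g₀ os).Bad
          (fun K t τ => (cr F θ hP g₀ os).A K t τ - (cr F θ hP g₀ os).shA K t τ) (fun K t τ => (cr F θ hP g₀ os).B K t τ - (cr F θ hP g₀ os).shB K t τ) δ ∧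
          Summable δ) :
    Spine (N := N) fun F D w => Node00.IsRecordOfRecord₁₃CCoPHOn F N Rg D w :=
  spine_rec13CCoPHOn_of_homes₁₃CoPHOn_holder cr β 𝔯 Rg h14 h15 h16 (s_N17_rRec₁₃CoPHOn_of_kernels_pin 𝔯 Rg ℓ hpin hs hκ hcr hdec h18)
    ((s_N18_rRec₁₃CoPHOn_iff_of_kernels_pin 𝔯 Rg ℓ hpin).mpr h18) ((s_N22_rRec₁₃CoPHOn_iff_of_kernels_pin 𝔯 Rg ℓ hpin).mpr h22) h20 h21 hx h19

/-- ★★ **THE SAME, SOCKET FORM — N18 ∕ N22 STATED ON THE RUN-LENGTH BUNDLES `(rateCarriersOfRecord₁₃CoPH 𝔯 F θ hP g₀ os k).u3`** (the conclusion shape of the producers'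
`…_rateCarriers_of_kernels_pin` faces — dag-n18-w1 `n18At_rateCarriers_of_kernels_pin_of_n22At_of_member`, dag-n22-w3 `n22At_rateCarriers_of_kernels_pin` — so a consumer plugs
them in by name; `rateStub_rRec₁₃CoPHOn_iff`).  (D4) from the four kernel inputs; N17 eliminated; the rest verbatim.  NOT a discharge. [bookkeeping] -/
theorem spine_rec13CCoPHOn_holder_of_kernels_pin_bundled
    (hpin : ∀ (F : T4Family) (θ : Stage13HParams F N) (hP : θ.Provisos₁₃CoPH F N) (g₀ : ℕ → ℝ) (os : List (ULoop F)),
      (𝔯.lit F θ hP g₀ os).u3 = objectsOfRecord₁₃ F N θ.toStage13Params (ℓ F θ))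
    (h14 : S_N14 (RRec₁₃CoPHOn 𝔯 Rg)) (h15 : S_N15 (RRec₁₃CoPHOn 𝔯 Rg)) (h16 : S_N16Holder β (RRec₁₃CoPHOn 𝔯 Rg))
    (h18 : ∀ (F : T4Family) (θ : Stage13HParams F N) (hP : θ.Provisos₁₃CoPH F N), Rg F θ → θ.Admissible F N → ∀ (g₀ : ℕ → ℝ) (os : List (ULoop F)) (k : ℕ),
      N18At (rateCarriersOfRecord₁₃CoPH 𝔯 F θ hP g₀ os k).u3)
    (h22 : ∀ (F : T4Family) (θ : Stage13HParams F N) (hP : θ.Provisos₁₃CoPH F N), Rg F θ → θ.Admissible F N → ∀ (g₀ : ℕ → ℝ) (os : List (ULoop F)) (k : ℕ),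
      N22At (rateCarriersOfRecord₁₃CoPH 𝔯 F θ hP g₀ os k).u3)
    (hs : ∀ (F : T4Family) (θ : Stage13HParams F N), θ.Provisos₁₃CoPH F N → Rg F θ → θ.Admissible F N → (ℓ F θ).Signs)
    (hκ : ∀ (F : T4Family) (θ : Stage13HParams F N), θ.Provisos₁₃CoPH F N → Rg F θ → θ.Admissible F N → 0 < (ℓ F θ).κ)
    (hcr : ∀ (F : T4Family) (θ : Stage13HParams F N), θ.Provisos₁₃CoPH F N → Rg F θ → θ.Admissible F N → betaPrime510 4 1 (ℓ F θ).κ ≤ (ℓ F θ).cr)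
    (hdec : ∀ (F : T4Family) (θ : Stage13HParams F N), θ.Provisos₁₃CoPH F N → Rg F θ → θ.Admissible F N → KernelDecayOfRecord₁₃ F N θ.toStage13Params 0 1 (ℓ F θ).κ)
    (h20 : S_N20 (SRec₁₃CoPHOn cr Rg)) (h21 : S_N21 (SRec₁₃CoPHOn cr Rg))
    (hx : ∀ (F : T4Family) (θ : Stage13HParams F N) (hP : θ.Provisos₁₃CoPH F N), Rg F θ → θ.Admissible F N →
      B16.EndStatementBPrinted (datumOfRecord₁₃CoPH F N θ hP).C → DagBinding.EndpointExistence (datumOfRecord₁₃CoPH F N θ hP).C.toB12 →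
        ForSmallCouplings (datumOfRecord₁₃CoPH F N θ hP) fun g₀ => ∀ os : List (ULoop F),
          0 < (cr F θ hP g₀ os).l₀ ∧ 0 < (cr F θ hP g₀ os).vol ∧
          (∀ (K : ℕ) (t : ℝ), |t| ≤ (cr F θ hP g₀ os).l₀ →
            T4GenFunBounds.schemeZ ((datumOfRecord₁₃CoPH F N θ hP).scheme g₀) os ((cr F θ hP g₀ os).K₀ + K) t =
              ∑ τ ∈ (cr F θ hP g₀ os).T K, (cr F θ hP g₀ os).A K t τ) ∧
          (∀ (K : ℕ) (t : ℝ), |t| ≤ (cr F θ hP g₀ os).l₀ →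
            T4GenFunBounds.schemeZ ((datumOfRecord₁₃CoPH F N θ hP).scheme g₀) os ((cr F θ hP g₀ os).K₀ + K + 1) t =
              ∑ τ ∈ (cr F θ hP g₀ os).T K, (cr F θ hP g₀ os).B K t τ))
    (h19 : ∀ (F : T4Family) (θ : Stage13HParams F N) (hP : θ.Provisos₁₃CoPH F N), Rg F θ → θ.Admissible F N → ∀ (g₀ : ℕ → ℝ) (os : List (ULoop F)),
      (∀ k : ℕ, RatesHolderAt (datumOfRecord₁₃CoPH F N θ hP) (rateCarriersOfRecord₁₃CoPH 𝔯 F θ hP g₀ os k) β) → letI := (cr F θ hP g₀ os).dec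
        ∃ δ : ℕ → ℝ, NE7.Core (cr F θ hP g₀ os).l₀ (cr F θ hP g₀ os).vol (cr F θ hP g₀ os).T (cr F θ hP g₀ os).Bad
          (fun K t τ => (cr F θ hP g₀ os).A K t τ - (cr F θ hP g₀ os).shA K t τ) (fun K t τ => (cr F θ hP g₀ os).B K t τ - (cr F θ hP g₀ os).shB K t τ) δ ∧
          Summable δ) :
    Spine (N := N) fun F D w => Node00.IsRecordOfRecord₁₃CCoPHOn F N Rg D w :=
  have h18' : S_N18 (RRec₁₃CoPHOn 𝔯 Rg) := (rateStub_rRec₁₃CoPHOn_iff 𝔯 Rg fun _ R => N18At R.u3).mpr h18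
  spine_rec13CCoPHOn_of_homes₁₃CoPHOn_holder cr β 𝔯 Rg h14 h15 h16
    (YMDAG.N17.s_N17_of_D4_N18 _ (s_D4_rRec₁₃CoPHOn_of_kernels_pin 𝔯 Rg ℓ hpin hs hκ hcr hdec) h18') h18'
    ((rateStub_rRec₁₃CoPHOn_iff 𝔯 Rg fun _ R => N22At R.u3).mpr h22) h20 h21 hx h19

end Summit.QuantumFields.YangMills.Theorems.BalabanUVNodesN27SpineRecord
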